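import Literature.AlgebraicGeometry.Resolution.CentreBlowupMohStability
import Literature.AlgebraicGeometry.Resolution.CentreBlowupOrdAlongBasics
import Literature.AlgebraicGeometry.Resolution.OrdZeroBasics
import HarnessLib

/-!
# [OURS · res-dim4-pi PR-2, part 1] The chart-ORIGIN dictionary of a coordinate-centre blow-up of
  `z^q + F` under Hauser–Perlega's condition (1) only

Cell `res-dim4-pi` (D-0157 DOOR 2, wave 2), brick **PR-2** (desk `boards/WAVE2.md`), seat `res-dim4-p-2`;
part 1 of 2 (part 2 = `PurelyInseparableDim4Perm2Bound.lean`: the rise bound `d′ ≤ 2d − g`, the loss-free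
monotonicity, the cell-vocabulary corollaries). Typed over the TREE's model `CentreBlowup.CState / step /
shade / ordAlong / degIn / chartExponent / chartTransform` (`PointBlowupShadeCentres.lean`,
`CentreBlowupMohStability.lean`, `CentreBlowupOrdAlongBasics.lean`); nothing is restated.

Setting (desk WORDS #1–#3, #10): a presented state `s = (F, r, exc)` of `z^q + F(x)`, `F` clean
(`deletePthPowers q F = F`), `x^r ∣ F` (`F = x^r · G`), `o = ord₀ F`, shade `d = o − |r|`; a coordinate
centre `V(z, x_S)` with condition (1) ONLY: `q ≤ degIn S e` for every monomial `x^e` of `F`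
(Hironaka-permissible = the MODE-1h centres of record; condition (2) is NOT assumed); chart `x_j`, `j ∈ S`;
the chart ORIGIN `b = 0` (the census' translation-free edges `t = 0`).

## What is proved (every exponent `q`, every field)
* §1.1 `chartExponent_injOn` (no two monomials collide), `isPthPowerExponent_chartExponent_iff` (the chart
  law `e′_j = degIn S e − q`, `e′_i = e_i` preserves AND reflects `q`-th-power exponents),
  `degree_chartExponent_add : |e′| + q = |e| + degIn (S ∖ j) e`;
* §1.2 `coeff_chartExponent_chartTransform`, `mem_support_chartTransform_iff`,
  **`deletePthPowers_chartTransform`: cleaning is VOID on the chart transform of a clean `F`**;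
* §1.3 `step_F_origin : (step q S j b s).F = chartTransform q S j F` at `b = 0`; `step_r_origin`,
  `step_exc_origin` (nothing lost); THE ORIGIN LAW `le_ordZero_step_origin_iff :
  m ≤ ord₀ F′ ⟺ ∀ x^e ∈ F, m + q ≤ |e| + degIn (S∖j) e` (so `ord₀ F′ = min_e (|e| + degIn (S∖j) e) − q`);
* §1.4 `origin_arith` (the `ℕ`-bookkeeping every bound of part 2 runs on: `|r′| + q = |r| + degIn (S∖j) r + g`
  with `g = ordAlong S F − degIn S r = ord_{(x_S)} G`, `|r| + g ≤ o`, an initial monomial, …) and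
  `le_shade_of_ordAlong_eq : g ≤ d` (so condition (2) `d ≤ g` means `g = d`).

Scope: chart origin only; the model's cleaning is the perfect-field deletion of `q`-th-power monomials.
[OURS · counted 0 · AI work weaker than expert review] NOTHING here proves resolution of singularities in
dimension ≥ 4 / characteristic `p`; bookkeeping about OUR candidate frame (MODE 1h coordinate game).
bears_on: LADDER-RESOLUTION:D157-DOOR2 (res-dim4-pi · PR-2). Supports stmt-ResolutionOfSingularities-16155
(helper).
-/

noncomputable section

set_option linter.dupNamespace false -- mandated namespace of this single-conjunct summit

open MvPolynomial Finset

open scoped BigOperators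

namespace Summit.ResolutionOfSingularities.ResolutionOfSingularities.Theorems.PIDim4

namespace Perm2Bound

open Literature.AlgebraicGeometry.Resolution
open Literature.AlgebraicGeometry.Resolution.CentreBlowup
open Literature.AlgebraicGeometry.Resolution.Hauser2010
open Literature.Barriers.ResolutionOfSingularities (ordZero_le_of_coeff_ne_zero le_ordZero_of_forall)

/-! ## §1 The chart-origin law (any exponent `q`) -/

section Origin

variable {σ : Type*} {K : Type*} [Field K] [Fintype σ] [DecidableEq σ] [DecidableEq K]

/-! ### §1.1 The chart law on exponents under condition (1) -/

omit [Fintype σ] in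
/-- `degIn S e = e_j + degIn (S.erase j) e` for `j ∈ S`. [folklore] -/
theorem degIn_eq_add_degIn_erase {S : Finset σ} {j : σ} (hj : j ∈ S) (e : σ →₀ ℕ) :
    degIn S e = e j + degIn (S.erase j) e := by
  unfold degIn
  rw [← Finset.add_sum_erase S (fun i => e i) hj]

omit [Fintype σ] in
/-- `degIn T r ≤ degIn T e` and `degIn T e − degIn T r ≤ |e| − |r|` for `r ≤ e`: the `T`-degree of the
quotient monomial `x^{e − r}` is at most its total degree. [folklore] -/
theorem degIn_sub_le_degree_sub [Fintype σ] (T : Finset σ) {r e : σ →₀ ℕ} (h : r ≤ e) :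
    degIn T r ≤ degIn T e ∧ degIn T e - degIn T r ≤ e.degree - r.degree := by
  have h1 := degIn_add_sum_compl T e
  have h2 := degIn_add_sum_compl T r
  have h3 : ∑ i ∈ Tᶜ, r i ≤ ∑ i ∈ Tᶜ, e i :=
    Finset.sum_le_sum fun i _ => Finsupp.le_def.mp h i
  have h4 : degIn T r ≤ degIn T e := degIn_le_degIn_of_le T h
  omega

omit [Fintype σ] in
/-- **The chart law is injective on the exponents allowed by condition (1)** (`j ∈ S`,
`q ≤ degIn S e`): no two monomials of `F` collide in the chart transform. [folklore] -/
theorem chartExponent_injOn {q : ℕ} {S : Finset σ} {j : σ} (hj : j ∈ S) {e e' : σ →₀ ℕ}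
    (he : q ≤ degIn S e) (he' : q ≤ degIn S e')
    (h : chartExponent q S j e = chartExponent q S j e') : e = e' := by
  have hoff : ∀ i, i ≠ j → e i = e' i := fun i hi => by
    have := congrArg (fun f => f i) h
    simpa only [chartExponent_apply_of_ne q S hi] using this
  have hjj : degIn S e - q = degIn S e' - q := by
    have := congrArg (fun f => f j) h
    simpa only [chartExponent_apply_self] using this
  have hS : degIn S e = degIn S e' := by omega
  have hT : degIn (S.erase j) e = degIn (S.erase j) e' :=
    Finset.sum_congr rfl fun i hi => hoff i (Finset.ne_of_mem_erase hi)
  have hej : e j = e' j := by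
    have h1 := degIn_eq_add_degIn_erase hj e
    have h2 := degIn_eq_add_degIn_erase hj e'
    omega
  ext i
  by_cases hi : i = j
  · subst hi; exact hej
  · exact hoff i hi

omit [Fintype σ] in
/-- **The chart law preserves and reflects `q`-th-power exponents** under condition (1): `x^{e′}` is a
`q`-th power monomial iff `x^e` is (`e′_i = e_i` off `j`, `e′_j = degIn S e − q` with `q ∣ degIn S e`
iff `q ∣ e_j` given the others). [folklore] -/
theorem isPthPowerExponent_chartExponent_iff {q : ℕ} {S : Finset σ} {j : σ} (hj : j ∈ S)
    {e : σ →₀ ℕ} (he : q ≤ degIn S e) :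
    IsPthPowerExponent q (chartExponent q S j e) ↔ IsPthPowerExponent q e := by
  rw [isPthPowerExponent_iff, isPthPowerExponent_iff]
  have hsplit := degIn_eq_add_degIn_erase hj e
  constructor
  · intro h
    have hoff : ∀ i, i ≠ j → q ∣ e i := fun i hi => by
      have := h i
      rwa [chartExponent_apply_of_ne q S hi] at this
    have hT : q ∣ degIn (S.erase j) e :=
      Finset.dvd_sum fun i hi => hoff i (Finset.ne_of_mem_erase hi)
    have hjq : q ∣ degIn S e - q := by
      have := h j
      rwa [chartExponent_apply_self] at this
    have hSq : q ∣ degIn S e := by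
      have : degIn S e = (degIn S e - q) + q := by omega
      rw [this]
      exact dvd_add hjq (dvd_refl q)
    intro i
    by_cases hi : i = j
    · subst hi
      rw [hsplit] at hSq
      exact (Nat.dvd_add_left hT).mp hSq
    · exact hoff i hi
  · intro h i
    by_cases hi : i = j
    · subst hi
      rw [chartExponent_apply_self]
      exact Nat.dvd_sub (Finset.dvd_sum fun k _ => h k) (dvd_refl q)
    · rw [chartExponent_apply_of_ne q S hi]
      exact h i

/-- **Degree of the chart image**: `|e′| + q = |e| + degIn (S ∖ j) e` (`j ∈ S`, `q ≤ degIn S e`).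
[folklore] -/
theorem degree_chartExponent_add {q : ℕ} {S : Finset σ} {j : σ} (hj : j ∈ S) {e : σ →₀ ℕ}
    (he : q ≤ degIn S e) :
    (chartExponent q S j e).degree + q = e.degree + degIn (S.erase j) e := by
  have h1 := PointBlowup.degree_update_add e j (degIn S e - q)
  have h2 := degIn_eq_add_degIn_erase hj e
  have h3 : chartExponent q S j e = e.update j (degIn S e - q) := rfl
  rw [← h3] at h1
  omega

/-! ### §1.2 The chart transform under condition (1): coefficients, support, no cleaning -/

omit [Fintype σ] [DecidableEq K] in
/-- Every monomial of the chart transform is the chart image of a monomial of `F`. [folklore] -/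
theorem exists_of_mem_support_chartTransform (q : ℕ) (S : Finset σ) (j : σ) (F : MvPolynomial σ K)
    {E : σ →₀ ℕ} (hE : E ∈ (chartTransform q S j F).support) :
    ∃ e ∈ F.support, chartExponent q S j e = E := by
  obtain ⟨e, he, -, h⟩ := PointBlowup.exists_of_mem_support_sum_monomial F.support
    (chartExponent q S j) (fun e => coeff e F) hE
  exact ⟨e, he, h⟩

omit [Fintype σ] [DecidableEq K] in
/-- **Coefficients of the chart transform** under condition (1): the coefficient of `x^{e′}` is the
coefficient of `x^e` (no two monomials collide). [folklore] -/
theorem coeff_chartExponent_chartTransform {q : ℕ} {S : Finset σ} {j : σ} (hj : j ∈ S)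
    {F : MvPolynomial σ K} (hq : ∀ e ∈ F.support, q ≤ degIn S e) {e : σ →₀ ℕ} (he : q ≤ degIn S e) :
    coeff (chartExponent q S j e) (chartTransform q S j F) = coeff e F := by
  by_cases hes : e ∈ F.support
  · unfold chartTransform
    exact PointBlowup.coeff_sum_monomial_of_injOn F.support (chartExponent q S j) (fun d => coeff d F)
      hes (fun d hd _ h => chartExponent_injOn hj (hq d hd) he h)
  · rw [MvPolynomial.notMem_support_iff.mp hes]
    by_contra hne
    obtain ⟨d, hd, hdE⟩ := exists_of_mem_support_chartTransform q S j F
      (MvPolynomial.mem_support_iff.mpr hne)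
    exact hes (chartExponent_injOn hj (hq d hd) he hdE ▸ hd)

omit [Fintype σ] [DecidableEq K] in
/-- **Support of the chart transform** under condition (1): `x^{e′}` occurs iff `x^e` does. [folklore] -/
theorem mem_support_chartTransform_iff {q : ℕ} {S : Finset σ} {j : σ} (hj : j ∈ S)
    {F : MvPolynomial σ K} (hq : ∀ e ∈ F.support, q ≤ degIn S e) {e : σ →₀ ℕ} (he : q ≤ degIn S e) :
    chartExponent q S j e ∈ (chartTransform q S j F).support ↔ e ∈ F.support := by
  rw [MvPolynomial.mem_support_iff, MvPolynomial.mem_support_iff,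
    coeff_chartExponent_chartTransform hj hq he]

omit [Fintype σ] [DecidableEq K] in
/-- **Cleaning is void on the chart transform of a clean `F`** under condition (1): no monomial of
`chartTransform q S j F` is a `q`-th power, because its preimage in `F` would be one. [folklore] -/
theorem deletePthPowers_chartTransform {q : ℕ} {S : Finset σ} {j : σ} (hj : j ∈ S)
    {F : MvPolynomial σ K} (hq : ∀ e ∈ F.support, q ≤ degIn S e)
    (hclean : deletePthPowers q F = F) :
    deletePthPowers q (chartTransform q S j F) = chartTransform q S j F := by
  ext E
  rw [coeff_deletePthPowers]
  split_ifs with hE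
  · symm
    by_contra hne
    obtain ⟨e, he, heE⟩ := exists_of_mem_support_chartTransform q S j F
      (MvPolynomial.mem_support_iff.mpr hne)
    rw [← heE] at hE
    exact PointBlowup.not_isPthPowerExponent_of_clean q hclean he
      ((isPthPowerExponent_chartExponent_iff hj (hq e he)).mp hE)
  · rfl

/-! ### §1.3 The step at the chart origin -/

omit [Fintype σ] in
/-- **At the chart origin the new residual polynomial IS the chart transform** (clean `F`, condition
(1), `j ∈ S`, `b = 0`): the translation is the identity and the cleaning deletes nothing. [folklore] -/
theorem step_F_origin {q : ℕ} {S : Finset σ} {j : σ} (hj : j ∈ S) (b : σ → K) (hb0 : ∀ i, b i = 0)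
    (s : CState σ K) (hclean : deletePthPowers q s.F = s.F) (hq : ∀ e ∈ s.F.support, q ≤ degIn S e) :
    (step q S j b s).F = chartTransform q S j s.F := by
  show deletePthPowers q (PointBlowup.translate b (chartTransform q S j s.F)) = _
  rw [PointBlowup.translate_eq_self b hb0, deletePthPowers_chartTransform hj hq hclean]

omit [Fintype σ] in
/-- At the chart origin no component is lost: `r′ = r.update j (ordAlong S F − q)`. [folklore] -/
theorem step_r_origin (q : ℕ) (S : Finset σ) (j : σ) (b : σ → K) (hb0 : ∀ i, b i = 0)
    (s : CState σ K) : (step q S j b s).r = s.r.update j ((ordAlong S s.F).toNat - q) := by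
  show newMult q S j b s = _
  unfold newMult
  congr 1
  ext i
  rw [Finsupp.filter_apply, if_pos (hb0 i)]

omit [Fintype σ] in
/-- At the chart origin every old component stays: `exc′ = insert j exc`. [folklore] -/
theorem step_exc_origin (q : ℕ) (S : Finset σ) (j : σ) (b : σ → K) (hb0 : ∀ i, b i = 0)
    (s : CState σ K) : (step q S j b s).exc = insert j s.exc := by
  show newExc j b s = _
  unfold newExc
  congr 1
  exact Finset.filter_true_of_mem fun i _ => hb0 i

/-- **THE ORIGIN LAW for the order.** At the chart origin (clean `F`, condition (1), `j ∈ S`):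
`m ≤ ord₀ F′ ⟺ m + q ≤ |e| + degIn (S ∖ j) e` for every monomial `x^e` of `F` — i.e.
`ord₀ F′ = min_e (|e| + degIn (S∖j) e) − q`, attained, no cancellation and no cleaning. [folklore] -/
theorem le_ordZero_step_origin_iff {q : ℕ} {S : Finset σ} {j : σ} (hj : j ∈ S) (b : σ → K)
    (hb0 : ∀ i, b i = 0) (s : CState σ K) (hclean : deletePthPowers q s.F = s.F)
    (hq : ∀ e ∈ s.F.support, q ≤ degIn S e) (m : ℕ) :
    (m : ℕ∞) ≤ ordZero (step q S j b s).F ↔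
      ∀ e ∈ s.F.support, m + q ≤ e.degree + degIn (S.erase j) e := by
  rw [step_F_origin hj b hb0 s hclean hq]
  constructor
  · intro h e he
    have hmem := (mem_support_chartTransform_iff hj hq (hq e he)).mpr he
    have hle := le_trans h (ordZero_le_of_coeff_ne_zero _ _ (MvPolynomial.mem_support_iff.mp hmem))
    have hle' : m ≤ (chartExponent q S j e).degree := by exact_mod_cast hle
    have := degree_chartExponent_add hj (hq e he)
    omega
  · intro h
    refine le_ordZero_of_forall _ m fun E hE => ?_
    obtain ⟨e, he, rfl⟩ := exists_of_mem_support_chartTransform q S j s.F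
      (MvPolynomial.mem_support_iff.mpr hE)
    have h1 := h e he
    have h2 := degree_chartExponent_add hj (hq e he)
    omega

/-- Upper half of the origin law: every monomial `x^e` of `F` bounds `ord₀ F′ + q ≤ |e| + degIn (S∖j) e`.
[folklore] -/
theorem ordZero_step_origin_add_le {q : ℕ} {S : Finset σ} {j : σ} (hj : j ∈ S) (b : σ → K)
    (hb0 : ∀ i, b i = 0) (s : CState σ K) (hclean : deletePthPowers q s.F = s.F)
    (hq : ∀ e ∈ s.F.support, q ≤ degIn S e) {e : σ →₀ ℕ} (he : e ∈ s.F.support) :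
    ordZero (step q S j b s).F + q ≤ ((e.degree + degIn (S.erase j) e : ℕ) : ℕ∞) := by
  rw [step_F_origin hj b hb0 s hclean hq]
  have hmem := (mem_support_chartTransform_iff hj hq (hq e he)).mpr he
  have hle := ordZero_le_of_coeff_ne_zero _ _ (MvPolynomial.mem_support_iff.mp hmem)
  rw [← degree_chartExponent_add hj (hq e he), Nat.cast_add]
  exact add_le_add hle le_rfl

/-! ### §1.4 The origin law in the letter `d` (shade), with `g = ord_{(x_S)} G` -/

/-- Bookkeeping at the chart origin, all in `ℕ`: the new order `o′`, `|r′| + q = |r| + degIn (S∖j) r + g`,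
`|r| + g ≤ o`, `q ≤ o`, the origin law for `o′`, an initial monomial, and the monomialwise bounds.
[folklore] -/
theorem origin_arith {q : ℕ} {S : Finset σ} {j : σ} (hj : j ∈ S) (b : σ → K)
    (hb0 : ∀ i, b i = 0) (s : CState σ K) (hclean : deletePthPowers q s.F = s.F)
    (hq : ∀ e ∈ s.F.support, q ≤ degIn S e) {o : ℕ} (ho : ordZero s.F = o)
    (hr : ∀ d ∈ s.F.support, s.r ≤ d) {g : ℕ}
    (hg : ordAlong S s.F = ((degIn S s.r + g : ℕ) : ℕ∞)) :
    ∃ o' : ℕ, ordZero (step q S j b s).F = o' ∧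
      (step q S j b s).r.degree + q = s.r.degree + degIn (S.erase j) s.r + g ∧
      s.r.degree + g ≤ o ∧ q ≤ o ∧
      (∀ m : ℕ, m ≤ o' ↔ ∀ d ∈ s.F.support, m + q ≤ d.degree + degIn (S.erase j) d) ∧
      (∃ d₀ ∈ s.F.support, d₀.degree = o ∧
        degIn (S.erase j) d₀ - degIn (S.erase j) s.r ≤ o - s.r.degree) ∧
      (∀ d ∈ s.F.support, o ≤ d.degree ∧ degIn (S.erase j) s.r ≤ degIn (S.erase j) d) := by
  obtain ⟨⟨d₀, hd₀, hd₀deg⟩, -⟩ := (ordZero_eq_nat_iff _ _).mp ho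
  have hd₀s : d₀ ∈ s.F.support := MvPolynomial.mem_support_iff.mpr hd₀
  have hall : ∀ d ∈ s.F.support, o ≤ d.degree ∧ degIn (S.erase j) s.r ≤ degIn (S.erase j) d := by
    intro d hd
    refine ⟨?_, (degIn_sub_le_degree_sub (S.erase j) (hr d hd)).1⟩
    have := ordZero_le_of_coeff_ne_zero _ _ (MvPolynomial.mem_support_iff.mp hd)
    rw [ho] at this
    exact_mod_cast this
  have halong : ∀ d ∈ s.F.support, degIn S s.r + g ≤ degIn S d := by
    intro d hd
    have := ordAlong_le_of_mem_support (S := S) hd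
    rw [hg] at this
    exact_mod_cast this
  have hro : s.r.degree ≤ o := hd₀deg ▸ PointBlowup.degree_le_degree_of_le (hr d₀ hd₀s)
  have hd₀S := degIn_sub_le_degree_sub S (hr d₀ hd₀s)
  have hgo : s.r.degree + g ≤ o := by
    have := halong d₀ hd₀s
    omega
  have hqo : q ≤ o := by
    have h1 := hq d₀ hd₀s
    have h2 := degIn_le_degree S d₀
    omega
  have hF : s.F ≠ 0 := ne_zero_of_ordZero_eq_natCast ho
  obtain ⟨d₁, hd₁, hd₁eq⟩ := exists_mem_support_ordAlong_eq S hF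
  have hqS : q ≤ degIn S s.r + g := by
    have h1 := hq d₁ hd₁
    rw [hg] at hd₁eq
    have h2 : degIn S s.r + g = degIn S d₁ := by exact_mod_cast hd₁eq
    omega
  have hr' : (step q S j b s).r.degree + q = s.r.degree + degIn (S.erase j) s.r + g := by
    rw [step_r_origin q S j b hb0 s, hg, ENat.toNat_coe]
    have h1 := PointBlowup.degree_update_add s.r j (degIn S s.r + g - q)
    have h2 := degIn_eq_add_degIn_erase hj s.r
    omega
  have hmem : chartExponent q S j d₀ ∈ (step q S j b s).F.support := by
    rw [step_F_origin hj b hb0 s hclean hq]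
    exact (mem_support_chartTransform_iff hj hq (hq d₀ hd₀s)).mpr hd₀s
  have hF' : (step q S j b s).F ≠ 0 := fun h => by
    rw [h, MvPolynomial.support_zero] at hmem
    exact Finset.notMem_empty _ hmem
  obtain ⟨o', ho'⟩ := exists_ordZero_eq_natCast hF'
  refine ⟨o', ho', hr', hgo, hqo, fun m => ?_, ⟨d₀, hd₀s, hd₀deg, ?_⟩, hall⟩
  · rw [← le_ordZero_step_origin_iff hj b hb0 s hclean hq m, ho']
    exact ENat.coe_le_coe.symm
  · have := degIn_sub_le_degree_sub (S.erase j) (hr d₀ hd₀s)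
    omega

omit [DecidableEq K] in
/-- **`g ≤ d`**: the order `g` of the residual factor `G` along `V(x_S)` never exceeds its order `d`
(so condition (2), `d ≤ g`, means `g = d`). [folklore] -/
theorem le_shade_of_ordAlong_eq (S : Finset σ) (s : CState σ K) {o : ℕ} (ho : ordZero s.F = o)
    (hr : ∀ d ∈ s.F.support, s.r ≤ d) {g : ℕ}
    (hg : ordAlong S s.F = ((degIn S s.r + g : ℕ) : ℕ∞)) : ((g : ℕ) : ℕ∞) ≤ s.shade := by
  obtain ⟨⟨d₀, hd₀, hd₀deg⟩, -⟩ := (ordZero_eq_nat_iff _ _).mp ho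
  have hd₀s : d₀ ∈ s.F.support := MvPolynomial.mem_support_iff.mpr hd₀
  have h1 : degIn S s.r + g ≤ degIn S d₀ := by
    have := ordAlong_le_of_mem_support (S := S) hd₀s
    rw [hg] at this
    exact_mod_cast this
  have h2 := degIn_sub_le_degree_sub S (hr d₀ hd₀s)
  rw [CState.shade_eq_of_ordZero_eq s ho]
  exact_mod_cast (show g ≤ o - s.r.degree by omega)

end Origin

end Perm2Bound

end Summit.ResolutionOfSingularities.ResolutionOfSingularities.Theorems.PIDim4

end
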